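import Summits.ResolutionOfSingularities.ResolutionOfSingularities.Theorems.MarkedTransferCampaignW46ThreefoldsStepExistsGeneral
import Summits.ResolutionOfSingularities.ResolutionOfSingularities.Theses.MarkedTransfer
import Literature.AlgebraicGeometry.Resolution.KollarBlowupSequenceFunctors
import HarnessLib

/-!
# [OURS · L1 W4.6 rung (ii)] THE Γ-FREE SHADOW OF THE HOST ITEM — `GammaFreeOrderReductionDimLeThree p`: hypersurface order
# reduction in dimension `≤ 3` by an `(I, m)`-permissible LSB (typed Def. 2.4), no boundary — and its two sources:
# the host item itself (calibration) and the typed procedure (rung (ii)) (one definition + proofs)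

Cell res-hironaka, LADDER-RESOLUTION rung L (D-0089), slot W4.6, rung (ii); seat res-L1-s46-pv-3 (gen 2). Host route
MarkedTransfer, host item `HypersurfaceOrderReductionDimLeThree` (stmt-ResolutionOfSingularities-16156); `--kind definition
--supports` it. Imports the route file `Theses/MarkedTransfer.lean` ONLY to state the comparison with the host item.

HONEST FRAMING. `GammaFreeOrderReductionDimLeThree p` is an OURS STATEMENT — [OURS · L1 W4.6 rung (ii)] it replaces the role of
«(ii) threefold hypersurfaces: the typed procedure terminates where stmt-16156 applies» AS A CONCLUSION ABOUT THE INPUT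
`(X, I, m)`; it is NOT a statement of H. Hironaka's manuscript (2017-03-23, [Hironaka2017]) and nothing of the manuscript is
asserted. It is the binder list of stmt-16156 VERBATIM (prime `p`, perfect `k` of characteristic `p`, `X` separated locally
of finite type quasi-compact integral regular over `k` with `topologicalKrullDim X ≤ 3`, `I ≠ 0` effective Cartier,
`m ≥ 1`) MINUS the boundary `E`/`HasSNC E`, with the conclusion `IsMarkedResolution ⟨I, E, m⟩ Φ M′` (boundary bookkeeping,
snc centres, empty final support) REPLACED by «there is an `(I, m)`-permissible LSB `Φ : X′ → X` of the typed Def. 2.4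
(`Hironaka2017.IsPermissibleLSB`: regular centres inside the successive loci of order `≥ m`, last transform `J′`) with
`ord_x J′ < m` everywhere». TWO SOURCES, both kernel theorems: (1) CALIBRATION — the host item implies it
(`gammaFree_of_hypersurfaceOrderReductionDimLeThree`: a marked resolution is in particular such an LSB, its regular
centres having radical ideals, tree `eq_vanishingIdeal_support_of_isRegular`), so the OURS statement is a WEAKENING of the
known case and not stronger than it; (2) RUNG (ii) — for the NAMED notion instance `N`: if for every perfect field `k` of
characteristic `p` there are a reading `Rd` and a string reading `σ` with the five `σ`-shapes at `regimeII` and résumé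
coverage of the standard unresolved regime-(ii) states, then `GammaFreeOrderReductionDimLeThree p`
(`gammaFree_of_shapes_of_cover`, via the capstone `exists_isPermissibleLSB_hostState_of_cover`). AI review is weaker than
expert review.

References: route MarkedTransfer `Theses/MarkedTransfer.lean` (stmt-16156, calibration: [CossartJannsenSaito2020,
KawanoueMatsuki2016]); `…ThreefoldsStepExistsGeneral`; tree `Resolution.MarkedIdeals` (`IsMarkedResolution`,
`IsMultipleBlowup` [BierstoneGrigorievMilmanWlodarczyk2011]), `Hironaka2017.PermissibleLSB` (Def. 2.4, transcribed).
H. Hironaka, ms. 2017-03-23, Def. 2.4 p.6, Th. 16.13 p.87 — scope only, under adjudication, not cited as fact. [Hironaka2017]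
-/

noncomputable section

set_option linter.dupNamespace false -- mandated namespace of this single-conjunct summit

open CategoryTheory AlgebraicGeometry TopologicalSpace

namespace Summit.ResolutionOfSingularities.ResolutionOfSingularities.Theorems

namespace CampaignW46

open Literature.AlgebraicGeometry.Resolution
open Literature.AlgebraicGeometry.Hironaka2017
open Literature.AlgebraicGeometry.Hironaka2017.S02Preliminaries
open Literature.AlgebraicGeometry.Hironaka2017.Datum
open Literature.AlgebraicGeometry.Hironaka2017.S15ARSchemes
open Literature.AlgebraicGeometry.Hironaka2017.S16Proof

universe u

/-! ## The Γ-free shadow of stmt-16156 -/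

/-- [OURS · L1 W4.6 rung (ii)] replaces the role of «(ii) threefold hypersurfaces: the typed Th. 16.6 procedure terminates —
and resolves — where MarkedTransfer `HypersurfaceOrderReductionDimLeThree` applies» as a statement ABOUT THE INPUT; NOT a
statement of the manuscript. Γ-FREE HYPERSURFACE ORDER REDUCTION IN DIMENSION `≤ 3` at the prime `p`: for every perfect
field `k` of characteristic `p`, every separated, locally-of-finite-type, quasi-compact, integral, regular `k`-scheme `X` with
`topologicalKrullDim X ≤ 3`, every effective Cartier ideal `I ≠ 0` and every `m ≥ 1`, there is an `(I, m)`-permissible LSB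
`Φ : X′ → X` (typed Def. 2.4 `Hironaka2017.IsPermissibleLSB`: a finite composite of blow-ups in regular centres inside the
successive loci of order `≥ m`, possibly localised) whose last transform `J′` has order `< m` at every point of `X′`. The
binders are those of stmt-16156 without the boundary; the conclusion is 16156's WITHOUT boundary/snc bookkeeping (implied by
it: `gammaFree_of_hypersurfaceOrderReductionDimLeThree`). [folklore] -/
def GammaFreeOrderReductionDimLeThree (p : ℕ) : Prop :=
  p.Prime → ∀ (k : Type u) [Field k] [CharP k p] [PerfectField k] (X : Scheme.{u}) (s : X ⟶ Spec (.of k)),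
    IsSeparated s → LocallyOfFiniteType s → QuasiCompact s → IsIntegral X → Scheme.IsRegular X →
      topologicalKrullDim X ≤ 3 → ∀ (I : X.IdealSheafData), I ≠ ⊥ → IsEffectiveCartier I → ∀ (m : ℕ), 1 ≤ m →
        ∃ (X' : Scheme.{u}) (Φ : X' ⟶ X) (J' : X'.IdealSheafData),
          IsPermissibleLSB I m Φ J' ∧ ∀ x : X', idealOrder J' x < m

/-! ## Source 1 (calibration): a marked resolution is an `(I, m)`-permissible LSB ending below order `m` -/

/-- **A multiple blow-up of marked ideals (BGMW Def. 3.1.3/3.1.4) is an `(𝓘, μ)`-permissible LSB (typed Def. 2.4) with last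
transform the final ideal**, and the multiplicity is unchanged: each centre `V(C)` is a REGULAR closed subscheme, so `C` is
radical, `C = 𝓘(V(C))` (tree `eq_vanishingIdeal_support_of_isRegular`), it lies in the support `{ord ≥ μ}`, and the
transform is the controlled transform with exponent `μ`. [folklore] -/
theorem isPermissibleLSB_of_isMultipleBlowup {X : Scheme.{u}} {M : MarkedIdeal X} :
    ∀ {X' : Scheme.{u}} {σ : X' ⟶ X} {M' : MarkedIdeal X'}, IsMultipleBlowup M σ M' →
      IsPermissibleLSB M.ideal M.mult σ M'.ideal ∧ M'.mult = M.mult := by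
  intro X' σ M' h
  induction h with
  | refl => exact ⟨IsPermissibleLSB.nil, rfl⟩
  | blowup h C τ hτ hC hsupp hsnc ih =>
    obtain ⟨ih1, ihm⟩ := ih
    refine ⟨?_, by simpa using ihm⟩
    have hCeq : C = Scheme.IdealSheafData.vanishingIdeal C.support := eq_vanishingIdeal_support_of_isRegular C hC
    have hreg : Scheme.IsRegular (Scheme.IdealSheafData.vanishingIdeal C.support).subscheme := by
      rw [← hCeq]
      exact hC
    have hτ' : IsBlowup τ (Scheme.IdealSheafData.vanishingIdeal C.support) := by
      rw [← hCeq]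
      exact hτ
    have key := IsPermissibleLSB.blowup ih1 C.support τ hreg (fun y hy => by
      have hy' := hsupp hy
      rw [← ihm]
      exact hy') hτ'
    rw [MarkedIdeal.transform_ideal, ihm]
    rw [← hCeq] at key
    exact key

/-- **SOURCE 1 (CALIBRATION): the host item implies its Γ-free shadow.** `HypersurfaceOrderReductionDimLeThree →
GammaFreeOrderReductionDimLeThree p` for every `p` (take the empty boundary: a marked resolution of `(I, [], m)` is an
`(I, m)`-permissible LSB with empty final support). So the OURS statement is WEAKER than the known case, never stronger.
The host item enters only as the hypothesis `h` (open in the tree, calibration). [folklore] -/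
theorem gammaFree_of_hypersurfaceOrderReductionDimLeThree
    (h : Theses.MarkedTransfer.HypersurfaceOrderReductionDimLeThree) (p : ℕ) :
    GammaFreeOrderReductionDimLeThree.{0} p := by
  intro hp k _ _ _ X s hsep hloft hqc hint hreg hdim I hI hIc m hm
  haveI := hloft
  haveI : IsLocallyNoetherian X := LocallyOfFiniteType.isLocallyNoetherian s
  obtain ⟨X', Φ, M', hmb, hsupp⟩ :=
    h p hp k X s hsep hloft hqc hint hreg hdim I hI hIc [] (hasSNC_nil_of_isRegular hreg) m hm
  obtain ⟨hlsb, hmult⟩ := isPermissibleLSB_of_isMultipleBlowup hmb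
  refine ⟨X', Φ, M'.ideal, hlsb, fun x => ?_⟩
  have hx : x ∉ M'.support := by
    rw [hsupp]
    exact Set.notMem_empty x
  have hx' : ¬ ((M'.mult : ℕ∞) ≤ idealOrder M'.ideal x) := hx
  rw [hmult] at hx'
  exact not_le.mp hx'

/-! ## Source 2 (rung (ii)): the typed procedure — five shapes and résumé coverage -/

/-- **SOURCE 2 (RUNG (ii)): the Γ-free shadow from the typed Th. 16.6 procedure.** For the NAMED notion instance `N`: if
for every perfect field `k` of characteristic `p` there are a reading `Rd` and a string reading `σ` (e.g. (M) `readingM N`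
or (M⁺) `readingMSucc N`) such that at the threefold-hypersurface states the five `σ`-shapes hold — Eq. (127) over the centre
off `∇′`, the prefix form of Eq. (128) on `∇′`, `m′ ≤ m`, «`∇(E)` = top stratum of `Sing(E)`», «no increase off the centre
at singular points» — and the résumés of `N` cover the standard unresolved regime-(ii) states, then
`GammaFreeOrderReductionDimLeThree p`. Everything between the hypotheses (about the résumés of `N` only) and the conclusion
is kernel-checked: termination by OUR MEASURE v2 (dimension bound `3` consumed), regime propagation, step existence
(blow-up of a component of the smooth terminal plat), exhaustion by Noetherian induction, Def. 2.4 bookkeeping. Nothing of the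
manuscript is asserted. [folklore] -/
theorem gammaFree_of_shapes_of_cover {n : ℕ} {p : ℕ} [Fact p.Prime] (N : Notions.{u} n)
    (hyp : ∀ (k : Type u) [Field k] [CharP k p] [PerfectField k],
      ∃ (Rd : Reading p k N) (σ : StringReading p k N),
        σ.DecreaseShape Rd regimeII ∧ σ.PrefixShape Rd regimeII ∧ σ.StopsShape Rd regimeII ∧
          σ.TopSingShape Rd regimeII ∧ σ.MonotoneSingShape Rd regimeII ∧
          ResumesCover N Rd (fun A E => regimeII A E ∧ E.IsStandard ∧ E.sing.Nonempty)) :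
    GammaFreeOrderReductionDimLeThree.{u} p := by
  intro _ k _ _ _ X s _ hloft hqc hint hreg hdim I hI hIc m hm
  obtain ⟨Rd, σ, hD, hP, hM, hT, hL, hC⟩ := hyp k
  haveI := hloft
  haveI := hqc
  haveI := hint
  exact exists_isPermissibleLSB_hostState_of_cover σ hD hP hM hT hL hC X s hreg hdim I hI hIc m hm

/-- The same with termination taken as the registered shape: if for every perfect `k` of characteristic `p` there is a
reading `Rd` with `TerminatesNablaII N Rd` and résumé coverage, then `GammaFreeOrderReductionDimLeThree p`. [folklore] -/
theorem gammaFree_of_terminates_of_cover {n : ℕ} {p : ℕ} [Fact p.Prime] (N : Notions.{u} n)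
    (hyp : ∀ (k : Type u) [Field k] [CharP k p] [PerfectField k],
      ∃ Rd : Reading p k N, TerminatesNablaII N Rd ∧
        ResumesCover N Rd (fun A E => regimeII A E ∧ E.IsStandard ∧ E.sing.Nonempty)) :
    GammaFreeOrderReductionDimLeThree.{u} p := by
  intro _ k _ _ _ X s _ hloft hqc hint hreg hdim I hI hIc m hm
  obtain ⟨Rd, hT, hC⟩ := hyp k
  haveI := hloft
  haveI := hqc
  haveI := hint
  exact exists_isPermissibleLSB_hostState_of_terminates hT hC X s hreg hdim I hI hIc m hm

end CampaignW46

end Summit.ResolutionOfSingularities.ResolutionOfSingularities.Theorems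

end
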